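import Literature.Analysis.FluidPDE.GKPRigidityBoundedClass
import Literature.Analysis.FluidPDE.GKPRegularityPersistence
import HarnessLib

/-!
# GKP Proposition 2.3 for the bounded class, stated over GKP's own class `𝓛^{1:∞}_p[T' < T]`

Analysis/FluidPDE proof file (theorems only: no definition, no named fact, no `sorry`)
continuing `GKPRigidityBoundedClass.lean` (Gallagher–Koch–Planchon 2016, Prop. 2.3, for Besov
mild solutions of the tree's class with uniformly bounded slices, modulo the far-field regularity
at the final time) with the same conclusion phrased for **GKP's class** `IsGKPSolutionOn`
(`GKPCriticalElements.lean`: a Besov mild solution of the critical class lying in the path space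
`𝓛^{1:∞}_{p,q}[T' < T]`) and **GKP's maximality** `IsMaximalGKPSolution` (GKP 2016, (1.3): `T*` is
the maximal time of `NS(u₀)` in `𝓛^{1:∞}_{p,q}`), which is the vocabulary of the faithful
statements of Thm. 1 / Props. 2.1–2.3 (`CriticalRegularity.lean`, §"Verdict clean-up"; the
shapes `hP1`–`hP3` of `hasSmoothExtensionPast_of_eHomBesovNorm_bounded_of_gkpProps3_pathSpace`,
`NSCriticalClosureBesovPathSpaceProps.lean`).

* `isGKPSolutionOn_zero` — the zero pair is a GKP solution on every `[0, T)` (zero Besov mild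
  solution, `isBesovMildSolutionOn_zero`; zero path norm, `memGKPPathSpace_zero`).
* `not_isMaximalGKPSolution_of_forall_ae_eq_zero`,
  `IsGKPSolutionOn.not_isMaximalGKPSolution_of_forall_Ioo_ae_eq_zero` — the endgame of §2.5 over
  GKP's class: a pair whose slices vanish a.e. on `[0, T)` — or on `(0, T)`, the time `t = 0`
  following by continuity in `Ḃ^{s_p}_{p,q}` — is extended by the zero GKP solution on
  `[0, T + 1)`, hence is not maximal in GKP's class ("therefore `T*(u₀) = +∞`").
* `IsGKPSolutionOn.not_isMaximalGKPSolution_of_bounded_of_farField_of_tendsto` — **Prop. 2.3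
  for the bounded class over GKP's class, modulo the far-field input**: a GKP solution of the
  class `(s_p, p, q)`, `3 < p < ∞`, `1 ≤ q < ∞`, with slices uniformly bounded on every
  `(0, T₁)`, classical on `(0, T)` through a representative `(v, π)`, with `U t → 0` in `𝓢'` as
  `t → T⁻` and far-field derivative bounds near `T`, is not maximal in GKP's class
  (`IsBesovMildSolutionOn.forall_eq_zero_of_bounded_of_farField_of_tendsto`).

## References

* I. Gallagher, G. S. Koch, F. Planchon, CMP 343 (2016) = arXiv:1407.4156: Prop. 2.3 and §2.5
  (p. 9), (1.3), (1.5). [GKP2016]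
-/

noncomputable section

open MeasureTheory TopologicalSpace Set Function Filter Metric
open _root_.Topology
open scoped ENNReal NNReal InnerProductSpace RealInnerProductSpace SchwartzMap

namespace Literature.Analysis.FluidPDE

/-! ### The zero GKP solution and the endgame over GKP's class -/

/-- **The zero pair is a GKP solution on every `[0, T)`** (GKP 2016, §1: `NS(0) = 0`,
`T*(0) = ∞`; the zero Besov mild solution `isBesovMildSolutionOn_zero` has zero path norm,
`memGKPPathSpace_zero`). [cite: GKP2016, §1 and (1.5)] -/
theorem isGKPSolutionOn_zero (p q : ℝ≥0∞) [Fact (1 ≤ p)] (T ν : ℝ) :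
    IsGKPSolutionOn p q T ν (0 : ℝ → EuclideanSpace ℝ (Fin 3) → EuclideanSpace ℝ (Fin 3))
      (0 : ℝ → 𝓢'(EuclideanSpace ℝ (Fin 3), EuclideanSpace ℂ (Fin 3))) :=
  ⟨isBesovMildSolutionOn_zero _ p q T ν, memGKPPathSpace_zero p q T⟩

/-- **Endgame of GKP §2.5 over GKP's class** ("`NS(u₀)(·, t) ≡ 0` … therefore
`T*(u₀) = +∞`"): if every slice `u t`, `t ∈ [0, T)`, vanishes a.e., then `(u, U)` is not a
maximal GKP solution with lifespan `T` — the zero GKP solution on `[0, T + 1)` extends it.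
[cite: GKP2016, §2.5] -/
theorem not_isMaximalGKPSolution_of_forall_ae_eq_zero {p q : ℝ≥0∞} [Fact (1 ≤ p)] {T ν : ℝ}
    {u : ℝ → EuclideanSpace ℝ (Fin 3) → EuclideanSpace ℝ (Fin 3)}
    {U : ℝ → 𝓢'(EuclideanSpace ℝ (Fin 3), EuclideanSpace ℂ (Fin 3))}
    (h0 : ∀ t ∈ Ico 0 T, u t =ᵐ[volume] 0) : ¬ IsMaximalGKPSolution p q T ν u U :=
  fun hmax => hmax.not_extendable
    ⟨T + 1, by linarith, 0, 0, isGKPSolutionOn_zero p q (T + 1) ν, fun t ht => (h0 t ht).symm⟩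

/-- **Endgame of GKP §2.5 over GKP's class, from vanishing at positive times only.** If
`(u, U)` is a GKP solution of the class `(s_p, p, q)` on `[0, T)`, `3 < p < ∞`, `1 ≤ q`, `0 < T`,
and `u t = 0` a.e. for every `t ∈ (0, T)` — the output of backward uniqueness and unique
continuation, which reach every positive time — then `(u, U)` is not maximal in GKP's class:
the distributions vanish on `(0, T)`, hence at `t = 0` by continuity in `Ḃ^{s_p}_{p,q}`
(`ContinuousInHomBesovOn.apply_zero_eq_zero_of_forall_Ioo`, `-1 < s_p < 0`), so `u 0 = 0` a.e.
as well (`IsDistributionOf.ae_eq`), and `not_isMaximalGKPSolution_of_forall_ae_eq_zero` applies.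
[cite: GKP2016, §2.5] -/
theorem IsGKPSolutionOn.not_isMaximalGKPSolution_of_forall_Ioo_ae_eq_zero {p q : ℝ≥0∞}
    [Fact (1 ≤ p)] {T ν : ℝ} (hp₃ : 3 < p) (hp : p < ∞) (hq : 1 ≤ q) (hT : 0 < T)
    {u : ℝ → EuclideanSpace ℝ (Fin 3) → EuclideanSpace ℝ (Fin 3)}
    {U : ℝ → 𝓢'(EuclideanSpace ℝ (Fin 3), EuclideanSpace ℂ (Fin 3))}
    (hu : IsGKPSolutionOn p q T ν u U) (h0 : ∀ t ∈ Ioo 0 T, u t =ᵐ[volume] 0) :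
    ¬ IsMaximalGKPSolution p q T ν u U := by
  have hB := hu.isBesovMildSolutionOn
  have hs := gkp_index_mem_Ioo hp₃ hp
  have hU0 : ∀ t ∈ Ioo 0 T, U t = 0 := fun t ht =>
    ((hB.isDistributionOf t ⟨ht.1.le, ht.2⟩).congr_ae (h0 t ht)).unique isDistributionOf_zero
  have hU00 : U 0 = 0 :=
    hB.continuousInHomBesovOn.apply_zero_eq_zero_of_forall_Ioo hs.2 (by linarith [hs.1]) hq hT hU0
  refine not_isMaximalGKPSolution_of_forall_ae_eq_zero fun t ht => ?_
  rcases ht.1.eq_or_lt with h | h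
  · rw [← h]
    exact (hB.isDistributionOf 0 ⟨le_rfl, hT⟩).ae_eq (by rw [hU00]; exact isDistributionOf_zero)
  · exact h0 t ⟨h, ht.2⟩

/-! ### Prop. 2.3 for the bounded class over GKP's class, modulo the far-field input -/

/-- **GKP 2016, Prop. 2.3 for bounded GKP solutions, modulo the far-field regularity at the
blow-up time — "`T*(u₀) = +∞`" in GKP's class.** Let `ν > 0`, `3 < p < ∞`, `1 ≤ q < ∞`, and let
`(u, U)` be a GKP solution of the class `(s_p, p, q)` on `[0, T)` (`IsGKPSolutionOn`: Besov mild
and in the path space `𝓛^{1:∞}_{p,q}[T' < T]`) whose slices are uniformly essentially bounded on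
every `(0, T₁)`, `T₁ < T`, with a classical representative `(v, π)` on `(0, T)` ((1.6)), such
that `U t → 0` in `𝓢'(ℝ³, ℂ³)` as `t → T⁻` (the hypothesis of Prop. 2.3) and
`‖D_xⁿv‖ ≤ K` (`n ≤ 3`) on a far-field region `(T₄, T) × {|x| > R}`, `0 < T₄ < T`, `R ≥ 0` (the
output of Prop. 2.8 and ε-regularity, cf. `GKPRigidityFarField.lean`). Then `(u, U)` is not a
maximal GKP solution with lifespan `T`: `v ≡ 0` on `(0, T)`
(`IsBesovMildSolutionOn.forall_eq_zero_of_bounded_of_farField_of_tendsto`) and the endgame over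
GKP's class applies. [cite: GKP2016, Prop. 2.3 and §2.5] -/
theorem IsGKPSolutionOn.not_isMaximalGKPSolution_of_bounded_of_farField_of_tendsto
    {ν T T₄ R K : ℝ} (hν : 0 < ν) {p q : ℝ≥0∞} [Fact (1 ≤ p)] (hp₃ : 3 < p) (hp : p < ∞)
    (hq₁ : 1 ≤ q) (hq : q < ∞) {u v : ℝ → EuclideanSpace ℝ (Fin 3) → EuclideanSpace ℝ (Fin 3)}
    {U : ℝ → 𝓢'(EuclideanSpace ℝ (Fin 3), EuclideanSpace ℂ (Fin 3))}
    {π : ℝ → EuclideanSpace ℝ (Fin 3) → ℝ} (hu : IsGKPSolutionOn p q T ν u U)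
    (hbd : ∀ T₁ ∈ Ioo 0 T, ∃ C : ℝ≥0∞, C < ∞ ∧ ∀ t ∈ Ioo 0 T₁, eLpNorm (u t) ∞ volume ≤ C)
    (hcl : IsClassicalNSSolutionOn (Ioo 0 T) ν 0 v π) (huv : ∀ t ∈ Ioo 0 T, u t =ᵐ[volume] v t)
    (hT₄ : 0 < T₄) (hT₄T : T₄ < T) (hR : 0 ≤ R)
    (hfar : ∀ n ≤ 3, ∀ w ∈ Ioo T₄ T ×ˢ (closedBall (0 : EuclideanSpace ℝ (Fin 3)) R)ᶜ,
      ‖iteratedFDeriv ℝ n (v w.1) w.2‖ ≤ K)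
    (hlim : Tendsto U (𝓝[<] T) (𝓝 0)) :
    ¬ IsMaximalGKPSolution p q T ν u U := by
  have hv0 := hu.isBesovMildSolutionOn.forall_eq_zero_of_bounded_of_farField_of_tendsto hν hp₃ hp
    hq₁ hq hbd hcl huv hT₄ hT₄T hR hfar hlim
  refine hu.not_isMaximalGKPSolution_of_forall_Ioo_ae_eq_zero hp₃ hp hq₁ (hT₄.trans hT₄T)
    fun t ht => ?_
  have h := huv t ht
  rw [hv0 t ht] at h
  exact h

end Literature.Analysis.FluidPDE

end
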